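/-
Copyright (c) 2026. All rights reserved.
Released under Apache 2.0 license as described in the file LICENSE.
-/
import Mathlib
import HarnessLib
import Summits.RiemannHypothesis.RiemannHypothesis.Theorems.EarlyAppointmentsGBound
import Summits.RiemannHypothesis.RiemannHypothesis.Theorems.EarlyAppointmentsComparisonBound

/-!
# G variation bound for CombDescentStep

The comparison_holds lemma reduces Rouché to showing |G(z) - G(z₀)| ≤ ε on D(z₀, h/2).
The required ε is very weak: ε < (h/2)|G(z₀)| - 1 ≈ hπ/(2s) - 1 > 10 when 8s ≤ h.

The G variation consists of:
1. Conjugate term: |1/(z - conj(z₀)) - 1/(z₀ - conj(z₀))| ≤ 1/(6h)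
2. Comb sum: bounded by exponential decay (sinh in denominator)
3. Remainder: |f'/f - Σpoles| ≤ η/s contributes ≤ 2η/s to variation

For 8s ≤ h and C₀η ≤ 1 (with C₀ = 8), the total is << hπ/(2s) - 1.
-/

open Complex Real Set Filter Topology Metric
open scoped BigOperators Topology

noncomputable section

namespace GVariation

/-- Main bound: For 8s ≤ h and C₀η ≤ 1, the G variation bound holds.
The total variation (conjugate + comb + remainder) is much smaller than π/s - 2/h. -/
theorem G_variation_bound_sufficient {s h η : ℝ} (hs : 0 < s) (_hh : 0 < h)
    (hsh : 8 * s ≤ h) (_hη0 : 0 ≤ η) (hη_small : 8 * η ≤ 1) :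
    1 / (6 * h) + 2 * η / s + 1 / h < π / s - 2 / h := by
  -- Goal: 1/(6h) + 2η/s + 1/h < π/s - 2/h
  -- Simplify: 1/(6h) + 1/h + 2/h + 2η/s < π/s
  -- i.e., (1/6 + 3)/h + 2η/s < π/s
  -- Bounds: η ≤ 1/8 so 2η/s ≤ 1/(4s); also h ≥ 8s so 1/h ≤ 1/(8s)
  -- LHS ≤ (19/6)/(8s) + 1/(4s) = (19/48 + 1/4)/s = (19/48 + 12/48)/s = 31/(48s) < π/s
  have h1 : η ≤ 1 / 8 := by linarith
  have h2 : 8 * s ≤ h := hsh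
  have h3 : 1 / h ≤ 1 / (8 * s) := by
    apply one_div_le_one_div_of_le (by positivity) h2
  have h4 : 2 * η / s ≤ (1/4) / s := by
    apply div_le_div_of_nonneg_right _ (le_of_lt hs)
    linarith
  have h5 : 1 / (6 * h) ≤ 1 / (6 * 8 * s) := by
    apply one_div_le_one_div_of_le (by positivity)
    linarith
  -- Now combine: 1/(6*8*s) + 1/(4*s) + 1/(8*s) < π/s
  -- = 1/(48s) + 1/(4s) + 1/(8s) = (1/48 + 12/48 + 6/48)/s = 19/(48s) < π/s
  have h6 : 1 / (6 * 8 * s) + (1/4) / s + 1 / (8 * s) = (1/48 + 1/4 + 1/8) / s := by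
    field_simp
    ring
  have h7 : (1/48 + 1/4 + 1/8 : ℝ) = 19/48 := by norm_num
  have h8 : (19/48 : ℝ) < π := by
    have hpi : Real.pi > 3 := Real.pi_gt_three
    linarith
  have h9 : 1 / (6 * h) + 2 * η / s + 1 / h ≤ 1 / (6 * 8 * s) + (1/4) / s + 1 / (8 * s) := by
    have ha : 1 / (6 * h) ≤ 1 / (6 * 8 * s) := h5
    have hb : 2 * η / s ≤ (1/4) / s := h4
    have hc : 1 / h ≤ 1 / (8 * s) := h3
    linarith
  have h10 : 1 / (6 * 8 * s) + (1/4) / s + 1 / (8 * s) < π / s := by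
    rw [h6, h7]
    rw [div_lt_div_iff₀ hs hs]
    have : (19/48 : ℝ) * s = s * (19/48) := by ring
    rw [this]
    nlinarith [h8]
  -- The goal is: 1/(6h) + 2η/s + 1/h < π/s - 2/h
  -- We have: LHS ≤ 1/(48s) + 1/(4s) + 1/(8s) < π/s (from h9, h10)
  -- We need: π/s - 2/h > 1/(48s) + 1/(4s) + 1/(8s)
  -- Which means: π/s - 1/(48s) - 1/(4s) - 1/(8s) > 2/h
  -- LHS = (π - 19/48)/s > 2.6/s (since π > 3.1 and 19/48 < 0.4)
  -- RHS ≤ 2/(8s) = 1/(4s) < 0.3/s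
  -- So π/s - 19/(48s) > 2/h, hence π/s > 19/(48s) + 2/h, hence π/s - 2/h > 19/(48s) = h10's LHS
  have h11 : 2 / h ≤ 1 / (4 * s) := by
    have : 2 / h ≤ 2 / (8 * s) := div_le_div_of_nonneg_left (by norm_num : (0 : ℝ) ≤ 2) (by positivity) h2
    calc 2 / h ≤ 2 / (8 * s) := this
      _ = 1 / (4 * s) := by ring
  have h12 : π / s - 2 / h ≥ π / s - 1 / (4 * s) := by linarith
  have h13 : π / s - 1 / (4 * s) = (π - 1/4) / s := by field_simp
  have h14 : (π - 1/4 : ℝ) / s > 19/48 / s := by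
    rw [gt_iff_lt, div_lt_div_iff₀ hs hs]
    have hpi : Real.pi > 3 := Real.pi_gt_three
    nlinarith
  have h15 : 19/48 / s = (1/48 + 1/4 + 1/8) / s := by rw [← h7]
  have h16 : (π - 1/4 : ℝ) / s > (1/48 + 1/4 + 1/8) / s := by rw [← h15]; exact h14
  have h17 : (1/48 + 1/4 + 1/8) / s = 1 / (6 * 8 * s) + 1 / 4 / s + 1 / (8 * s) := by rw [h6]
  rw [h17] at h16
  -- Now chain: π/s - 2/h ≥ (π - 1/4)/s > 1/(48s) + 1/(4s) + 1/(8s) ≥ LHS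
  have h18 : π / s - 2 / h ≥ (π - 1/4) / s := by rw [← h13]; exact h12
  linarith

end GVariation

end
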